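import Mathlib
import HarnessLib
import Summits.Langlands.Langlands.Theses.ParityBlindBianchi
import Summits.Langlands.Langlands.Theorems.ParityBlindBianchiArtinWeightRealisationLevelSplit
import Literature.NumberTheory.Automorphic.TwistedHeckeTheoryGL2
import Literature.NumberTheory.Automorphic.StrongArtinGL2
import Literature.NumberTheory.Automorphic.OddArtinWeightOne
import Literature.NumberTheory.Automorphic.BookerStrongArtin
import Literature.NumberTheory.Automorphic.BaseChangeCyclicCuspidal

/-!
# SKELETON (continuation lead c34, re-audit HONEST-BET, 2026-08-17T04:3xZ) — crux stmt-Langlands-15111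
`ParityBlindBianchi.ArtinWeightRealisationLevel` (R′), line `Sketch` (7 registered stubs along the staged sector split S / E / G)

Lean body byte-identical to the c32/c33 skeleton (registered sha d03114f5 under c33).  Delta since c33 (04:04Z): route rev 17
APPLIED (Theses/ParityBlindBianchi.lean 04:13:28Z) — the deciding theorem `closes` now binds `hR : ArtinWeightRealisationEven`
(R″, stmt-Langlands-16619) and R′ is listed under "SUPPORTS, NOT IN closes (vestigial since rev 17)"; item retriaged crux → support
(04:10:43Z) and HELD ("do not staff").  Unchanged: item stmt-Langlands-11057 open/unclaimed (`updated` 2026-08-16T21:03:44Z);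
no `_holds` for LT / KW / Booker / AC / JL (`JacquetLanglands1970_twistedHeckeTheoryGL2`, `…standardLTheoryGL2`; Literature
programme active 04:1xZ); Disproof.lean v1.2 unchanged (2026-08-16T12:22:40Z, "no kill possible").
The composition below proves the crux BY NAME through the landed split glue `artinWeightRealisationLevel_of_sectors : S → E → G → R′`
(p139884; pure logic) from SEVEN registered stubs: five named Literature facts BY NAME (Langlands–Tunnell `strongArtin_of_isSolvable`,
Khare–Wintenberger odd Artin `khareWintenberger_artinConjecture_of_isOdd`, Booker 2003 `booker_strongArtin_of_artinConjecture`,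
Arthur–Clozel 4.2 (a) `baseChange_cyclic_cuspidal`, Jacquet–Langlands 1970 `JacquetLanglands1970_twistedHeckeTheoryGL2`) and the two
open children of the staged split VERBATIM (`stub_evenTwistSector` = E, `stub_genuineSector` = G).  Open strength = {item 11057, JL}
(E, G ⟸ R + JL by `sectors_of_artinWeightRealisationLevel` ∘ p121004; R′ → R unconditional, p108329).  Hardest stub (held by the
lead): `stub_genuineSector` (= R's genuine icosahedral core, NonRegularWeightBarrier verbatim; no host: STRATEGY-CENSUS §3, B1–B4).
Wave: none possible (two open problems + five XL named facts owned by Literature programmes) — recorded in NOTES/HANDOFF.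
-/

noncomputable section

open scoped BigOperators Topology Classical Matrix NumberField MatrixGroups nonZeroDivisors
open Literature.NumberTheory.Automorphic Literature.NumberTheory.GaloisRepresentations
  IsDedekindDomain NumberField Field Filter Topology Set

-- `Summit.Langlands.Langlands.…`: summit = sub-problem name (D-0017 nested layout), not a typo.
set_option linter.dupNamespace false

namespace Summit.Langlands.Langlands.Theorems.ArtinWeightRealisationLevel

/-! ## The five named Literature facts, BY NAME (theorems in print; `_holds` pending in the Literature programme) -/

/-- **STUB = NAMED FACT** Langlands–Tunnell: strong Artin for two-dimensional `σ` with solvable projective image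
(Langlands 1980, Tunnell 1981), `Literature/NumberTheory/Automorphic/StrongArtinGL2.lean`. [cite: Tunnell1981] -/
theorem stub_strongArtinOfIsSolvable : strongArtin_of_isSolvable := by
  sorry

/-- **STUB = NAMED FACT** Khare–Wintenberger 2009, Thm. 10.1 (ii): Artin's conjecture for odd two-dimensional `ρ` over `ℚ`,
`Literature/NumberTheory/Automorphic/OddArtinWeightOne.lean`. [cite: KhareWintenberger2009, Thm. 10.1] -/
theorem stub_khareWintenbergerOddArtin : khareWintenberger_artinConjecture_of_isOdd := by
  sorry

/-- **STUB = NAMED FACT** Booker 2003, Corollary p. 1090: Artin's conjecture for `ρ` implies strong Artin for `ρ` (`GL₂/ℚ`),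
`Literature/NumberTheory/Automorphic/BookerStrongArtin.lean` (tagged `@[conjecture]` in the tree pending its in-tree reduction to
Booker–Krishnamurthy + the Artin functional equation + Langlands' lemma, `BookerStrongArtinNonCuspidal`). [cite: Booker2003, Corollary] -/
theorem stub_bookerStrongArtin : booker_strongArtin_of_artinConjecture := by
  sorry

/-- **STUB = NAMED FACT** Arthur–Clozel 1989, Ch. 3 Thm. 4.2 (a): cyclic base change of cuspidal representations of `GL₂`,
`Literature/NumberTheory/Automorphic/BaseChangeCyclicCuspidal.lean`. [cite: ArthurClozelAMS120, Ch. 3 Thm. 4.2 (a)] -/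
theorem stub_baseChangeCyclicCuspidal : baseChange_cyclic_cuspidal := by
  sorry

/-- **STUB = NAMED FACT** Jacquet–Langlands 1970, Thm. 11.1 / Cor. 11.2 (twisted Hecke theory of `GL(2)`, giving Gelbart 1997
Prop. 4.1 at every good place), `Literature/NumberTheory/Automorphic/TwistedHeckeTheoryGL2.lean`; fact claim 730 released-partial
(missing `standardLTheoryGL2_holds`), Literature programme active. [cite: JacquetLanglands1970, Thm. 11.1, Cor. 11.2] -/
theorem stub_twistedHeckeTheoryGL2 : JacquetLanglands1970_twistedHeckeTheoryGL2 := by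
  sorry

/-! ## The two open children of the staged split, VERBATIM -/

/-- **STUB = CHILD E `ArtinRealisationLevelEvenTwist`** of the staged split (crux; the sector `closes` consumes: R′ restricted to
`σ = (ρ|_{Γ_K}) ⊗ ψ` with `ρ : Γ_ℚ → GL₂(ℚ̄_p)` of finite image and NOT odd, `ψ` of finite image; pointwise spelling of the twist).
Target-strength modulo print (`evenTwist_sector_of_target`); open problem (NonRegularWeightBarrier at the U(2,2) wall, TRIAGE-r2-3).
[folklore] -/
theorem stub_evenTwistSector : ∀ (K : Type) [Field K] [NumberField K], NumberField.IsTotallyComplex K → Module.finrank ℚ K = 2 → ∀ (p : ℕ) [Fact p.Prime] (ι : PadicAlgCl p ≃+* ℂ) (σ : Literature.NumberTheory.GaloisRepresentations.FramedGaloisRep K (PadicAlgCl p) 2), Finite σ.toMonoidHom.range → σ.toGaloisRep.IsIrreducible → (∃ (ρ : Literature.NumberTheory.GaloisRepresentations.FramedGaloisRep ℚ (PadicAlgCl p) 2) (ψ : Field.absoluteGaloisGroup K →ₜ* (PadicAlgCl p)ˣ), Finite ρ.toMonoidHom.range ∧ ¬ ρ.IsOdd ∧ Finite ψ.toMonoidHom.range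 ∧ (∀ g : Field.absoluteGaloisGroup K, ((σ g : GL (Fin 2) (PadicAlgCl p)) : Matrix (Fin 2) (Fin 2) (PadicAlgCl p)) = ((ψ g : (PadicAlgCl p)ˣ) : PadicAlgCl p) • (((Literature.NumberTheory.GaloisRepresentations.FramedGaloisRep.restrictField K ρ) g : GL (Fin 2) (PadicAlgCl p)) : Matrix (Fin 2) (Fin 2) (PadicAlgCl p)))) → ∀ S₀ : Finset ℕ, p ∈ S₀ → (∃ (U : Subgroup (GL (Fin 2) (IsDedekindDomain.FiniteAdeleRing (NumberField.RingOfIntegers K) K))) (ϖ : ∀ v : IsDedekindDomain.HeightOneSpectrum (NumberField.RingOfIntegers K), (v.adicCompletion K)ˣ) (a : {v : IsDedekindDomain.HeightOneSpectrum (NumberField.RingOfIntegers K) // ∀ ℓ ∈ S₀, ((ℓ : ℕ) : NumberField.RingOfIntegers K) ∉ v.asIdeal} → ℕ → (Valued.v (R := PadicAlgCl p)).valuationSubring), IsOpen (U : Set (GL (Fin 2) (IsDedekindDomain.FiniteAdeleRing (NumberField.RingOfIntegers K) K))) ∧ U ≤ Literature.NumberTheory.Automorphic.glFiniteIntegralLevel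 2 K ∧ (∀ g ∈ Literature.NumberTheory.Automorphic.glFiniteIntegralLevel 2 K, (∀ v : IsDedekindDomain.HeightOneSpectrum (NumberField.RingOfIntegers K), ¬ (∀ ℓ ∈ S₀, ((ℓ : ℕ) : NumberField.RingOfIntegers K) ∉ v.asIdeal) → ∀ i j : Fin 2, ((g : Matrix (Fin 2) (Fin 2) (IsDedekindDomain.FiniteAdeleRing (NumberField.RingOfIntegers K) K)) i j) v = (1 : Matrix (Fin 2) (Fin 2) (v.adicCompletion K)) i j) → g ∈ U) ∧ (∀ v : IsDedekindDomain.HeightOneSpectrum (NumberField.RingOfIntegers K), Valued.v ((ϖ v : (v.adicCompletion K)ˣ) : v.adicCompletion K) = WithZero.exp (-1 : ℤ)) ∧ Literature.NumberTheory.Automorphic.IsHeckePoint (Matrix.GeneralLinearGroup.map (n := Fin 2) (algebraMap K (IsDedekindDomain.FiniteAdeleRing (NumberField.RingOfIntegers K) K))) (Literature.NumberTheory.Automorphic.LevelTower.ofSeq U (fun r : ℕ => (Literature.NumberTheory.Automorphic.principalCongruenceLevel 2 K (Ideal.span {((p : ℕ) : NumberField.RingOfIntegers K)} ^ r)).map (Literature.NumberTheory.Automorphic.GLn.sndHom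 2 K))) ((p : ℕ) : (Valued.v (R := PadicAlgCl p)).valuationSubring) (fun j : {v : IsDedekindDomain.HeightOneSpectrum (NumberField.RingOfIntegers K) // ∀ ℓ ∈ S₀, ((ℓ : ℕ) : NumberField.RingOfIntegers K) ∉ v.asIdeal} × Fin 2 => Literature.NumberTheory.Automorphic.GLn.sndHom 2 K (Literature.NumberTheory.Automorphic.heckeDiagAt 2 K j.1.1 (ϖ j.1.1) (j.2.val + 1))) (fun j => a j.1 (j.2.val + 1)) ∧ ∀ (v : IsDedekindDomain.HeightOneSpectrum (NumberField.RingOfIntegers K)) (hv : ∀ ℓ ∈ S₀, ((ℓ : ℕ) : NumberField.RingOfIntegers K) ∉ v.asIdeal), σ.IsHeckeAssociatedAt v (fun i : ℕ => if i = 0 then (1 : PadicAlgCl p) else ((a ⟨v, hv⟩ i : (Valued.v (R := PadicAlgCl p)).valuationSubring) : PadicAlgCl p))) → ∃ (hcpt : Literature.NumberTheory.Automorphic.isCompact_glFiniteIntegralLevel 2 K) (π : Literature.NumberTheory.Automorphic.CuspidalAutomorphicRepData 2 K hcpt), ∀ w : IsDedekindDomain.HeightOneSpectrum (NumberField.RingOfIntegers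 K), (∀ ℓ ∈ S₀, ((ℓ : ℕ) : NumberField.RingOfIntegers K) ∉ w.asIdeal) → SatakeFrobCompatibleAt ι π.1 σ w := by
  sorry

/-- **STUB = CHILD G `ArtinRealisationLevelGenuine`** of the staged split (crux; R′ restricted to the `σ` with INSOLUBLE projective
image that are NOT a twist of a restriction from `ℚ`): the wall shared with item stmt-Langlands-11057 — modulo print theorems and the
route's own target G is all that is open in R′ (`artinWeightRealisationLevel_of_genuine_sector_of_target`), and the route never
instantiates it; no host known (STRATEGY-CENSUS §3 S3–S7, barrier notes B1–B4). HARDEST STUB, held by the lead. [folklore] -/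
theorem stub_genuineSector : ∀ (K : Type) [Field K] [NumberField K], NumberField.IsTotallyComplex K → Module.finrank ℚ K = 2 → ∀ (p : ℕ) [Fact p.Prime] (ι : PadicAlgCl p ≃+* ℂ) (σ : Literature.NumberTheory.GaloisRepresentations.FramedGaloisRep K (PadicAlgCl p) 2), Finite σ.toMonoidHom.range → σ.toGaloisRep.IsIrreducible → ¬ IsSolvable (Literature.NumberTheory.GaloisRepresentations.projectiveImage σ.toMonoidHom) → ¬ (∃ (ρ : Literature.NumberTheory.GaloisRepresentations.FramedGaloisRep ℚ (PadicAlgCl p) 2) (ψ : Field.absoluteGaloisGroup K →ₜ* (PadicAlgCl p)ˣ), Finite ρ.toMonoidHom.range ∧ Finite ψ.toMonoidHom.range ∧ (∀ g : Field.absoluteGaloisGroup K, ((σ g : GL (Fin 2) (PadicAlgCl p)) : Matrix (Fin 2) (Fin 2) (PadicAlgCl p)) = ((ψ g : (PadicAlgCl p)ˣ) : PadicAlgCl p) • (((Literature.NumberTheory.GaloisRepresentations.FramedGaloisRep.restrictField K ρ) g : GL (Fin 2) (PadicAlgCl p)) : Matrix (Fin 2) (Fin 2) (PadicAlgCl p))))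 → ∀ S₀ : Finset ℕ, p ∈ S₀ → (∃ (U : Subgroup (GL (Fin 2) (IsDedekindDomain.FiniteAdeleRing (NumberField.RingOfIntegers K) K))) (ϖ : ∀ v : IsDedekindDomain.HeightOneSpectrum (NumberField.RingOfIntegers K), (v.adicCompletion K)ˣ) (a : {v : IsDedekindDomain.HeightOneSpectrum (NumberField.RingOfIntegers K) // ∀ ℓ ∈ S₀, ((ℓ : ℕ) : NumberField.RingOfIntegers K) ∉ v.asIdeal} → ℕ → (Valued.v (R := PadicAlgCl p)).valuationSubring), IsOpen (U : Set (GL (Fin 2) (IsDedekindDomain.FiniteAdeleRing (NumberField.RingOfIntegers K) K))) ∧ U ≤ Literature.NumberTheory.Automorphic.glFiniteIntegralLevel 2 K ∧ (∀ g ∈ Literature.NumberTheory.Automorphic.glFiniteIntegralLevel 2 K, (∀ v : IsDedekindDomain.HeightOneSpectrum (NumberField.RingOfIntegers K), ¬ (∀ ℓ ∈ S₀, ((ℓ : ℕ) : NumberField.RingOfIntegers K) ∉ v.asIdeal) → ∀ i j : Fin 2, ((g : Matrix (Fin 2) (Fin 2) (IsDedekindDomain.FiniteAdeleRing (NumberField.RingOfIntegers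 K) K)) i j) v = (1 : Matrix (Fin 2) (Fin 2) (v.adicCompletion K)) i j) → g ∈ U) ∧ (∀ v : IsDedekindDomain.HeightOneSpectrum (NumberField.RingOfIntegers K), Valued.v ((ϖ v : (v.adicCompletion K)ˣ) : v.adicCompletion K) = WithZero.exp (-1 : ℤ)) ∧ Literature.NumberTheory.Automorphic.IsHeckePoint (Matrix.GeneralLinearGroup.map (n := Fin 2) (algebraMap K (IsDedekindDomain.FiniteAdeleRing (NumberField.RingOfIntegers K) K))) (Literature.NumberTheory.Automorphic.LevelTower.ofSeq U (fun r : ℕ => (Literature.NumberTheory.Automorphic.principalCongruenceLevel 2 K (Ideal.span {((p : ℕ) : NumberField.RingOfIntegers K)} ^ r)).map (Literature.NumberTheory.Automorphic.GLn.sndHom 2 K))) ((p : ℕ) : (Valued.v (R := PadicAlgCl p)).valuationSubring) (fun j : {v : IsDedekindDomain.HeightOneSpectrum (NumberField.RingOfIntegers K) // ∀ ℓ ∈ S₀, ((ℓ : ℕ) : NumberField.RingOfIntegers K) ∉ v.asIdeal} × Fin 2 => Literature.NumberTheory.Automorphic.GLn.sndHom 2 K (Literature.NumberTheory.Automorphic.heckeDiagAt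 2 K j.1.1 (ϖ j.1.1) (j.2.val + 1))) (fun j => a j.1 (j.2.val + 1)) ∧ ∀ (v : IsDedekindDomain.HeightOneSpectrum (NumberField.RingOfIntegers K)) (hv : ∀ ℓ ∈ S₀, ((ℓ : ℕ) : NumberField.RingOfIntegers K) ∉ v.asIdeal), σ.IsHeckeAssociatedAt v (fun i : ℕ => if i = 0 then (1 : PadicAlgCl p) else ((a ⟨v, hv⟩ i : (Valued.v (R := PadicAlgCl p)).valuationSubring) : PadicAlgCl p))) → ∃ (hcpt : Literature.NumberTheory.Automorphic.isCompact_glFiniteIntegralLevel 2 K) (π : Literature.NumberTheory.Automorphic.CuspidalAutomorphicRepData 2 K hcpt), ∀ w : IsDedekindDomain.HeightOneSpectrum (NumberField.RingOfIntegers K), (∀ ℓ ∈ S₀, ((ℓ : ℕ) : NumberField.RingOfIntegers K) ∉ w.asIdeal) → SatakeFrobCompatibleAt ι π.1 σ w := by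
  sorry

/-! ## Composition -/

/-- Child S (solvable-or-odd-twist sector) DERIVED from the five fact stubs by the landed
`solvableOrOddTwist_sector_of_facts` (p139884). [folklore] -/
theorem solvableOrOddTwistSector_of_stubs : ∀ (K : Type) [Field K] [NumberField K], NumberField.IsTotallyComplex K → Module.finrank ℚ K = 2 → ∀ (p : ℕ) [Fact p.Prime] (ι : PadicAlgCl p ≃+* ℂ) (σ : Literature.NumberTheory.GaloisRepresentations.FramedGaloisRep K (PadicAlgCl p) 2), Finite σ.toMonoidHom.range → σ.toGaloisRep.IsIrreducible → IsSolvable (Literature.NumberTheory.GaloisRepresentations.projectiveImage σ.toMonoidHom) ∨ (∃ (ρ : Literature.NumberTheory.GaloisRepresentations.FramedGaloisRep ℚ (PadicAlgCl p) 2) (ψ : Field.absoluteGaloisGroup K →ₜ* (PadicAlgCl p)ˣ), Finite ρ.toMonoidHom.range ∧ ρ.IsOdd ∧ Finite ψ.toMonoidHom.range ∧ (∀ g : Field.absoluteGaloisGroup K, ((σ g : GL (Fin 2) (PadicAlgCl p)) : Matrix (Fin 2) (Fin 2) (PadicAlgCl p)) = ((ψ g : (PadicAlgCl p)ˣ) :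 PadicAlgCl p) • (((Literature.NumberTheory.GaloisRepresentations.FramedGaloisRep.restrictField K ρ) g : GL (Fin 2) (PadicAlgCl p)) : Matrix (Fin 2) (Fin 2) (PadicAlgCl p)))) → ∀ S₀ : Finset ℕ, p ∈ S₀ → (∃ (U : Subgroup (GL (Fin 2) (IsDedekindDomain.FiniteAdeleRing (NumberField.RingOfIntegers K) K))) (ϖ : ∀ v : IsDedekindDomain.HeightOneSpectrum (NumberField.RingOfIntegers K), (v.adicCompletion K)ˣ) (a : {v : IsDedekindDomain.HeightOneSpectrum (NumberField.RingOfIntegers K) // ∀ ℓ ∈ S₀, ((ℓ : ℕ) : NumberField.RingOfIntegers K) ∉ v.asIdeal} → ℕ → (Valued.v (R := PadicAlgCl p)).valuationSubring), IsOpen (U : Set (GL (Fin 2) (IsDedekindDomain.FiniteAdeleRing (NumberField.RingOfIntegers K) K))) ∧ U ≤ Literature.NumberTheory.Automorphic.glFiniteIntegralLevel 2 K ∧ (∀ g ∈ Literature.NumberTheory.Automorphic.glFiniteIntegralLevel 2 K, (∀ v : IsDedekindDomain.HeightOneSpectrum (NumberField.RingOfIntegers K), ¬ (∀ ℓ ∈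 S₀, ((ℓ : ℕ) : NumberField.RingOfIntegers K) ∉ v.asIdeal) → ∀ i j : Fin 2, ((g : Matrix (Fin 2) (Fin 2) (IsDedekindDomain.FiniteAdeleRing (NumberField.RingOfIntegers K) K)) i j) v = (1 : Matrix (Fin 2) (Fin 2) (v.adicCompletion K)) i j) → g ∈ U) ∧ (∀ v : IsDedekindDomain.HeightOneSpectrum (NumberField.RingOfIntegers K), Valued.v ((ϖ v : (v.adicCompletion K)ˣ) : v.adicCompletion K) = WithZero.exp (-1 : ℤ)) ∧ Literature.NumberTheory.Automorphic.IsHeckePoint (Matrix.GeneralLinearGroup.map (n := Fin 2) (algebraMap K (IsDedekindDomain.FiniteAdeleRing (NumberField.RingOfIntegers K) K))) (Literature.NumberTheory.Automorphic.LevelTower.ofSeq U (fun r : ℕ => (Literature.NumberTheory.Automorphic.principalCongruenceLevel 2 K (Ideal.span {((p : ℕ) : NumberField.RingOfIntegers K)} ^ r)).map (Literature.NumberTheory.Automorphic.GLn.sndHom 2 K))) ((p : ℕ) : (Valued.v (R := PadicAlgCl p)).valuationSubring) (fun j : {v : IsDedekindDomain.HeightOneSpectrum (NumberField.RingOfIntegers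 K) // ∀ ℓ ∈ S₀, ((ℓ : ℕ) : NumberField.RingOfIntegers K) ∉ v.asIdeal} × Fin 2 => Literature.NumberTheory.Automorphic.GLn.sndHom 2 K (Literature.NumberTheory.Automorphic.heckeDiagAt 2 K j.1.1 (ϖ j.1.1) (j.2.val + 1))) (fun j => a j.1 (j.2.val + 1)) ∧ ∀ (v : IsDedekindDomain.HeightOneSpectrum (NumberField.RingOfIntegers K)) (hv : ∀ ℓ ∈ S₀, ((ℓ : ℕ) : NumberField.RingOfIntegers K) ∉ v.asIdeal), σ.IsHeckeAssociatedAt v (fun i : ℕ => if i = 0 then (1 : PadicAlgCl p) else ((a ⟨v, hv⟩ i : (Valued.v (R := PadicAlgCl p)).valuationSubring) : PadicAlgCl p))) → ∃ (hcpt : Literature.NumberTheory.Automorphic.isCompact_glFiniteIntegralLevel 2 K) (π : Literature.NumberTheory.Automorphic.CuspidalAutomorphicRepData 2 K hcpt), ∀ w : IsDedekindDomain.HeightOneSpectrum (NumberField.RingOfIntegers K), (∀ ℓ ∈ S₀, ((ℓ : ℕ) : NumberField.RingOfIntegers K) ∉ w.asIdeal) → SatakeFrobCompatibleAt ι π.1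 σ w :=
  solvableOrOddTwist_sector_of_facts stub_strongArtinOfIsSolvable stub_khareWintenbergerOddArtin stub_bookerStrongArtin
    stub_baseChangeCyclicCuspidal stub_twistedHeckeTheoryGL2

/-- **The crux BY NAME** from the seven stubs, through the landed split glue
`artinWeightRealisationLevel_of_sectors : S → E → G → R′` (p139884; pure logic). [folklore] -/
theorem ArtinWeightRealisationLevel_of :
    Summit.Langlands.Langlands.Theses.ParityBlindBianchi.ArtinWeightRealisationLevel :=
  artinWeightRealisationLevel_of_sectors solvableOrOddTwistSector_of_stubs stub_evenTwistSector stub_genuineSector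

end Summit.Langlands.Langlands.Theorems.ArtinWeightRealisationLevel

end
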